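/-
Copyright (c) 2026 the pub-hodgecm-mathlib formalisation cell (harness21).  Prover seat hodgecm-mathlib-K2E3-p21 (g3), HCML Track B «K2-LIT» (build stream 29),
h413 = `stmt-HodgeConjecture-24833`, line `K2_E3_EllipticInputs`, unit U12 «Characters», socket #11 road (11-SC), letter (SC-an): HARISH-CHANDRA'S THEOREM 20 FOR
THE MODEL `U(σ, Φ₃)(K)` ON THE FULL LEVEL `K₁ = U ∩ GL₃(𝒪)` AND WITH A COMPACT-EXHAUSTION `Ω` (the shapes line lead K2E3-p20 (g3) asked for, `K2/STATUS.md` 02:08:19Z (A3)).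
2026-09-04.
-/
import Summits.HodgeConjecture.HodgeConjecture.Theorems.K2E3CuspFormCancellationU3          -- ★ (this seat) p856699: `cuspForm_cancellation_U3`, `isClosed_coe_N∕Nbar`, `isCompact_isOpen_conjLevel`; brings ★ U3Inputs, U3Torus, (T20-c), (T20-e1∕e2)
import Summits.HodgeConjecture.HodgeConjecture.Theorems.K2E3CuspFormCancellationLevelOne    -- ★ (T20-e1′) p856672 (K2E3-p14 (g3)): `cuspForm_cancellation_levelOne` (the `K₀(y) ↝ K₁` upgrade, abstract)
import HarnessLib

/-!
# h413 ∕ Track B «K2-LIT», (SC-an) Theorem-20 line — THEOREM 20 FOR `U(σ, Φ₃)(K)` ON THE FULL LEVEL `K₁`, WITH `Ω` A COMPACT EXHAUSTION AND `supp f ⊆ C·T`, `C` COMPACT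
# `∃ m_C, ∀ s y, y ∈ Ω_s → ∀ x ∉ Ω_{m_C + (1 + 2s + 4m_C) + s}, ∫_{K₁} f(x k y) dμ(k) = 0`  (Harish-Chandra 1970, Part VII §2 Theorem 20 p. 70; §3 p. 71; §8 pp. 80–84)

Cell `pub/hodgecm-mathlib`, crux H413 = `stmt-HodgeConjecture-24833`, route of record `HCCMUnconditional`; chair K2-lead (g0), dealer K2E3-plan (g2), line lead K2E3-p20 (g3).
THEOREMS ONLY (no `def`, no `instance`, no `notation`, no named-fact hypothesis, no `sorry`); lane `--supports stmt-HodgeConjecture-24833 --as helper`, count-neutral.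

WHAT THIS FILE DOES (the junction shapes requested by the line lead, 02:08:19Z (A3), for [M3] of the (SC-an) end-game map): ★ p856699 `cuspForm_cancellation_U3` is THEOREM 20 for
the rank-one model at the conjugate level `K_m ⊓ y⁻¹K_m y`, for an arbitrary family `Ω : ℕ → Set U` with the three height-ball clauses and a support datum `C ⊆ Ω_{m_C}`.  Here:
* §1 `cuspForm_cancellation_levelOne_U3` — the FULL-LEVEL form `∫_{K₁} f(x k y) dμ(k) = 0`, `K₁ := K_{γ=1} ∩ U = U ∩ GL₃(𝒪)` (★ `congruenceGL` at `γ = 1`), for `μ` left AND right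
  invariant (the organ's local groups are unimodular; ★ consumer currency `[IsMulRightInvariant]`), via ★ (T20-e1′) `cuspForm_cancellation_levelOne` (K2E3-p14 (g3)) with every
  structural hypothesis discharged as in ★ p856699 (`K_m ≤ K₁ ⊆ Ω_0`: ★ `congruenceGL_mono` + ★ U3Inputs `coe_level_subset_heightBall_zero`; `K₁` compact open: ★
  `isCompact_isOpen_comap_congruenceGL` at `γ = 1`), at the fixed level `m = 1` (`K₀ := K_{|ϖ|} ∩ U`).
* §2 `cuspForm_cancellation_levelOne_U3_of_isCompact` ∕ `cuspForm_cancellation_U3_of_isCompact` — the same with `Ω : CompactExhaustion U` (★ p856390's output type) and the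
  support datum in ★ (T20-b)'s shape `∃ C, IsCompact C ∧ ∀ x, f x ≠ 0 → x ∈ C * ↑T` (`T = torusU σ J`): the compact `C` is swallowed by some `Ω_{m_C}` (Mathlib
  `CompactExhaustion.exists_superset_of_isCompact`), whence **`∃ m_C, ∀ s y, y ∈ Ω_s → ∀ x ∉ Ω_{m_C + (1 + 2s + 4m_C) + s}, ∫_{K₁} f(x k y) dμ = 0`** (and the conjugate-level twin).

HONEST LABEL.  HC_CM is proved only modulo the 7 printed citations (2 remaining named inputs: hLiu418 = `stmt-HodgeConjecture-24832`, h413 = `stmt-HodgeConjecture-24833`)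
until rung 0 closes; count-neutral helper.

## References
* [HarishChandra1970] Harish-Chandra (notes by G. van Dijk), *Harmonic Analysis on Reductive p-adic Groups*, LNM 162 (1970), Part VII §2 Theorem 20 p. 70; §3 p. 71
  («`∫_{K₁} f_γ(x k y₀) dk = 0` unless `1 + σ(xk) ≤ c(1+σ(C_γ))(1+σ(y₀))`»); §8 pp. 80–84.
* [Folland1995] G. B. Folland, *A Course in Abstract Harmonic Analysis* (1995), §2.4 (unimodular groups).
-/

set_option autoImplicit false
set_option linter.dupNamespace false  -- the mandated namespace repeats the single-problem summit's segment (`HodgeConjecture.HodgeConjecture`)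

noncomputable section

open scoped MatrixGroups WithZero Pointwise
open MeasureTheory Topology ValuativeRel Matrix
open Literature.NumberTheory.Automorphic Literature.NumberTheory.Automorphic.UnitaryGroup
open Summit.HodgeConjecture.HodgeConjecture.Cruxes.H413.K2E3CuspFormCancellationU3Inputs
open Summit.HodgeConjecture.HodgeConjecture.Cruxes.H413.K2E3CuspFormCancellationU3

namespace Summit.HodgeConjecture.HodgeConjecture.Cruxes.H413.K2E3CuspFormCancellationU3LevelOne

section Model

variable {K : Type*} [Field K] [Valued K ℤᵐ⁰] [ValuativeRel K] [(Valued.v : Valuation K ℤᵐ⁰).Compatible] [IsNonarchimedeanLocalField K]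
  (σ : K →+* K) (hσc : Continuous σ) (hσv : ∀ x, Valued.v (σ x) = Valued.v x)
  {J : Matrix (Fin 3) (Fin 3) K} (hJ : J = (StdForm.antidiagonal 3).over K)
  [MeasurableSpace ↥(unitaryGroupOfForm σ J)] [BorelSpace ↥(unitaryGroupOfForm σ J)]
  [SecondCountableTopology ↥(unitaryGroupOfForm σ J)] [LocallyCompactSpace ↥(unitaryGroupOfForm σ J)]
  (μ : Measure ↥(unitaryGroupOfForm σ J)) [μ.IsHaarMeasure] [μ.IsMulRightInvariant]
  (ν : Measure ↥((borelTriple σ J hJ).N)) [SFinite ν] [ν.IsOpenPosMeasure] [IsFiniteMeasureOnCompacts ν] [ν.IsMulLeftInvariant]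
  (νbar : Measure ↥(((borelTriple σ J hJ).N).map (MulAut.conj (weylLongU σ hJ)).toMonoidHom))
  [SFinite νbar] [νbar.IsOpenPosMeasure] [IsFiniteMeasureOnCompacts νbar] [νbar.IsMulLeftInvariant]
  {ϖ : K} (hϖ : Valued.v ϖ = WithZero.exp (-1 : ℤ))

/-! ## §1 The full level `K₁ = U ∩ GL₃(𝒪)` for a general height-ball family `Ω` -/

include hσc hσv hϖ in
/-- **THEOREM 20 FOR `U(σ, Φ₃)(K)` ON THE FULL LEVEL `K₁ = K_{γ=1} ∩ U = U ∩ GL₃(𝒪)`** (print p. 71: «`∫_{K₁} f_γ(x k y₀) dk = 0` unless …»): `Ω` any family with ★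
p856390's membership ∕ inversion ∕ submultiplicativity clauses, `μ` left AND right invariant Haar, `ν∕ν̄` left Haar on `↥N∕↥N̄`, `f : U → E` continuous with `supp f ⊆ C·T`,
`C ⊆ Ω_{m_C}`, cusp along `N` and `N̄`.  Then for `y ∈ Ω_s` and `x ∉ Ω_{m_C + (1 + 2s + 4m_C) + s}`:  **`∫_{k ∈ K₁} f(x k y) dμ(k) = 0`** (★ (T20-e1′)
`cuspForm_cancellation_levelOne` at `K₀ := K_{|ϖ|} ∩ U`, all structural hypotheses discharged as in ★ `cuspForm_cancellation_U3`).
[cite: HarishChandra1970, Part VII §2 Theorem 20 p. 70; §3 p. 71; §8 pp. 80–84] [cite: Folland1995, §2.4] -/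
theorem cuspForm_cancellation_levelOne_U3 (Ω : ℕ → Set ↥(unitaryGroupOfForm σ J))
    (hmem : ∀ (m : ℕ) (g : ↥(unitaryGroupOfForm σ J)), g ∈ Ω m ↔
      (∀ i j, Valued.v (ϖ ^ m * ((g : GL (Fin 3) K) : Matrix (Fin 3) (Fin 3) K) i j) ≤ 1) ∧
        ∀ i j, Valued.v (ϖ ^ m * (((g : GL (Fin 3) K)⁻¹ : GL (Fin 3) K) : Matrix (Fin 3) (Fin 3) K) i j) ≤ 1)
    (hinv : ∀ (m : ℕ) (g : ↥(unitaryGroupOfForm σ J)), g ∈ Ω m → g⁻¹ ∈ Ω m)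
    (hmul : ∀ (a b : ℕ) (g h : ↥(unitaryGroupOfForm σ J)), g ∈ Ω a → h ∈ Ω b → g * h ∈ Ω (a + b))
    {s : ℕ} {y : ↥(unitaryGroupOfForm σ J)} (hy : y ∈ Ω s)
    {E : Type*} [NormedAddCommGroup E] [NormedSpace ℝ E]
    (f : ↥(unitaryGroupOfForm σ J) → E) (hf : Continuous f) (C : Set ↥(unitaryGroupOfForm σ J)) {mC : ℕ} (hC : C ⊆ Ω mC)
    (hsupp : ∀ g, f g ≠ 0 → g ∈ C * (((borelTriple σ J hJ).M : Subgroup ↥(unitaryGroupOfForm σ J)) : Set ↥(unitaryGroupOfForm σ J)))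
    (hcusp : ∀ x : ↥(unitaryGroupOfForm σ J), ∫ n : ↥((borelTriple σ J hJ).N), f (x * ↑n) ∂ν = 0)
    (hcuspbar : ∀ x : ↥(unitaryGroupOfForm σ J), ∫ v : ↥(((borelTriple σ J hJ).N).map (MulAut.conj (weylLongU σ hJ)).toMonoidHom), f (x * ↑v) ∂νbar = 0)
    {x : ↥(unitaryGroupOfForm σ J)} (hx : x ∉ Ω (mC + (1 + 2 * s + 4 * mC) + s)) :
    ∫ k in (((congruenceGL 3 (1 : ValueGroupWithZero K)).comap (unitaryGroupOfForm σ J).subtype : Subgroup ↥(unitaryGroupOfForm σ J)) :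
      Set ↥(unitaryGroupOfForm σ J)), f (x * k * y) ∂μ = 0 := by
  -- the level `γ = |ϖ|`: `0 ≠ γ < 1`
  have hϖv1 : valuation K ϖ < 1 := by
    rw [← v_lt_one_iff_valuation_lt_one, hϖ, ← WithZero.exp_zero, WithZero.exp_lt_exp]; norm_num
  have hϖv0 : valuation K ϖ ≠ 0 :=
    (Valuation.ne_zero_iff _).2 (Literature.NumberTheory.Automorphic.CartanUnique.uniformizer_ne_zero hϖ)
  have hγ1 : valuation K ϖ ^ 1 < 1 := by rw [pow_one]; exact hϖv1
  have hγ0 : valuation K ϖ ^ 1 ≠ 0 := pow_ne_zero _ hϖv0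
  have hγle : valuation K ϖ ^ 1 ≤ 1 := hγ1.le
  obtain ⟨hK₁c, hK₁o⟩ := isCompact_isOpen_comap_congruenceGL σ hσc (one_ne_zero : (1 : ValueGroupWithZero K) ≠ 0) (J := J)
  obtain ⟨-, hK₀o⟩ := isCompact_isOpen_comap_congruenceGL σ hσc hγ0 (J := J)
  have hyΩ := (hmem s y).1 hy
  refine K2E3CuspFormCancellationLevelOne.cuspForm_cancellation_levelOne μ Ω
    ((congruenceGL 3 (1 : ValueGroupWithZero K)).comap (unitaryGroupOfForm σ J).subtype)
    ((congruenceGL 3 (valuation K ϖ ^ 1)).comap (unitaryGroupOfForm σ J).subtype) (borelTriple σ J hJ).M (borelTriple σ J hJ).N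
    (((borelTriple σ J hJ).N).map (MulAut.conj (weylLongU σ hJ)).toMonoidHom) (borelTriple σ J hJ).M
    {a : ↥(unitaryGroupOfForm σ J) | ∃ d : Fin 3 → Kˣ, glDiagonal 3 K d = (a : GL (Fin 3) K) ∧ 1 ≤ Valued.v (d 0 : K)}
    {a : ↥(unitaryGroupOfForm σ J) | ∃ d : Fin 3 → Kˣ, glDiagonal 3 K d = (a : GL (Fin 3) K) ∧ Valued.v (d 0 : K) ≤ 1}
    (fun j => (congruenceGL 3 (valuation K ϖ ^ j)).comap (unitaryGroupOfForm σ J).subtype) ν νbar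
    (fun hg hg' => hmul _ _ _ _ hg hg') (fun hg => hinv _ _ hg)
    (coe_level_subset_heightBall_zero σ Ω hmem _) (Subgroup.comap_mono (congruenceGL_mono hγle)) hy (fun u hu => ?_) hK₁o hK₁c hK₀o
    (isClosed_coe_N σ hJ) (isClosed_coe_Nbar σ hJ) f hf C hC hsupp hcusp hcuspbar (torusU_mem_plus_or_minus σ hJ)
    (fun k hk => ?_) (fun k hk => ?_)
    (fun a ha t ht => conj_mem_level_of_mem_torusU σ hJ _ ha ht)
    (fun a ha n hn => conj_mem_N_of_mem_torusU σ hJ ha hn) (fun a ha v hv => conj_mem_Nbar_of_mem_torusU σ hJ ha hv)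
    (mem_heightBall_two_mul_of_mul_mem_N σ hσv hJ hϖ Ω hmem hinv hmul) (mem_heightBall_two_mul_of_mul_mem_Nbar σ hσv hJ hϖ Ω hmem hinv hmul)
    (conj_mem_level_of_plus_of_mem_Nbar σ hσv hJ hγle) (inv_conj_mem_level_of_plus_of_mem_N σ hσv hJ hϖ Ω hmem hinv)
    (conj_mem_level_of_minus_of_mem_N σ hσv hJ hγle) (inv_conj_mem_level_of_minus_of_mem_Nbar σ hσv hJ hϖ Ω hmem hinv) hx
  · exact ⟨(Subgroup.mem_inf.1 (K2E3IwahoriFactorisedLevelU3.comap_congruenceGL_le_inf_map_conj_of_heightBall σ hϖ 1 s hyΩ hu)).1,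
      (K2E3IwahoriFactorisedLevelU3.conj_mem_comap_congruenceGL_of_heightBall σ hϖ 1 s hyΩ hu).1⟩
  · obtain ⟨⟨nb, t, n, hnb, ht, hn, h⟩, -⟩ := K2E3IwahoriFactorisedLevelU3.exists_iwahori_factorisations_of_mem_comap_congruenceGL σ hJ hγ1 hk
    exact ⟨nb, hnb, t, ht, n, hn, h⟩
  · obtain ⟨-, ⟨n, t, nb, hn, ht, hnb, h⟩⟩ := K2E3IwahoriFactorisedLevelU3.exists_iwahori_factorisations_of_mem_comap_congruenceGL σ hJ hγ1 hk
    exact ⟨n, hn, t, ht, nb, hnb, h⟩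

/-! ## §2 `Ω` a compact exhaustion, support datum `∃ C compact`: the line lead's junction shapes -/

include hσc hσv hϖ in
/-- **THEOREM 20 FOR `U(σ, Φ₃)(K)` ON `K₁`, COMPACT-EXHAUSTION ∕ COMPACT-SUPPORT SHAPE**: `Ω : CompactExhaustion U` with ★ p856390's three clauses, `f` continuous with
`∃ C, IsCompact C ∧ supp f ⊆ C·T` (★ (T20-b)'s shape), cusp along `N`, `N̄`; then **`∃ m_C, ∀ s y, y ∈ Ω_s → ∀ x ∉ Ω_{m_C + (1 + 2s + 4m_C) + s}, ∫_{K₁} f(x k y) dμ = 0`**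
(the compact `C` is swallowed by some `Ω_{m_C}`, `CompactExhaustion.exists_superset_of_isCompact`). [cite: HarishChandra1970, Part VII §2 Theorem 20 p. 70; §3 p. 71] -/
theorem cuspForm_cancellation_levelOne_U3_of_isCompact (Ω : CompactExhaustion ↥(unitaryGroupOfForm σ J))
    (hmem : ∀ (m : ℕ) (g : ↥(unitaryGroupOfForm σ J)), g ∈ Ω m ↔
      (∀ i j, Valued.v (ϖ ^ m * ((g : GL (Fin 3) K) : Matrix (Fin 3) (Fin 3) K) i j) ≤ 1) ∧
        ∀ i j, Valued.v (ϖ ^ m * (((g : GL (Fin 3) K)⁻¹ : GL (Fin 3) K) : Matrix (Fin 3) (Fin 3) K) i j) ≤ 1)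
    (hinv : ∀ (m : ℕ) (g : ↥(unitaryGroupOfForm σ J)), g ∈ Ω m → g⁻¹ ∈ Ω m)
    (hmul : ∀ (a b : ℕ) (g h : ↥(unitaryGroupOfForm σ J)), g ∈ Ω a → h ∈ Ω b → g * h ∈ Ω (a + b))
    {E : Type*} [NormedAddCommGroup E] [NormedSpace ℝ E]
    (f : ↥(unitaryGroupOfForm σ J) → E) (hf : Continuous f)
    (hsupp : ∃ C : Set ↥(unitaryGroupOfForm σ J), IsCompact C ∧ ∀ g, f g ≠ 0 → g ∈ C * ((torusU σ J : Subgroup ↥(unitaryGroupOfForm σ J)) : Set ↥(unitaryGroupOfForm σ J)))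
    (hcusp : ∀ x : ↥(unitaryGroupOfForm σ J), ∫ n : ↥((borelTriple σ J hJ).N), f (x * ↑n) ∂ν = 0)
    (hcuspbar : ∀ x : ↥(unitaryGroupOfForm σ J), ∫ v : ↥(((borelTriple σ J hJ).N).map (MulAut.conj (weylLongU σ hJ)).toMonoidHom), f (x * ↑v) ∂νbar = 0) :
    ∃ mC : ℕ, ∀ (s : ℕ) (y : ↥(unitaryGroupOfForm σ J)), y ∈ Ω s → ∀ x : ↥(unitaryGroupOfForm σ J), x ∉ Ω (mC + (1 + 2 * s + 4 * mC) + s) →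
      ∫ k in (((congruenceGL 3 (1 : ValueGroupWithZero K)).comap (unitaryGroupOfForm σ J).subtype : Subgroup ↥(unitaryGroupOfForm σ J)) :
        Set ↥(unitaryGroupOfForm σ J)), f (x * k * y) ∂μ = 0 := by
  obtain ⟨C, hCc, hC⟩ := hsupp
  obtain ⟨mC, hmC⟩ := Ω.exists_superset_of_isCompact hCc
  exact ⟨mC, fun s y hy x hx => cuspForm_cancellation_levelOne_U3 σ hσc hσv hJ μ ν νbar hϖ Ω hmem hinv hmul hy f hf C hmC hC hcusp hcuspbar hx⟩

include hσc hσv hϖ in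
omit [μ.IsMulRightInvariant] in
/-- **THEOREM 20 FOR `U(σ, Φ₃)(K)` AT THE CONJUGATE LEVEL `K_m(y⁻¹) = K_m ⊓ y⁻¹K_m y`, COMPACT-EXHAUSTION ∕ COMPACT-SUPPORT SHAPE** (`μ` only a left Haar measure here): for
`1 ≤ m`, `∃ m_C, ∀ s y, y ∈ Ω_s → ∀ x ∉ Ω_{m_C + (m + 2s + 4m_C) + s}, ∫_{K_m(y⁻¹)} f(x y k) dμ = 0` (★ p856699 `cuspForm_cancellation_U3`).
[cite: HarishChandra1970, Part VII §2 Theorem 20 p. 70; §8 pp. 80–84] -/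
theorem cuspForm_cancellation_U3_of_isCompact (Ω : CompactExhaustion ↥(unitaryGroupOfForm σ J))
    (hmem : ∀ (m : ℕ) (g : ↥(unitaryGroupOfForm σ J)), g ∈ Ω m ↔
      (∀ i j, Valued.v (ϖ ^ m * ((g : GL (Fin 3) K) : Matrix (Fin 3) (Fin 3) K) i j) ≤ 1) ∧
        ∀ i j, Valued.v (ϖ ^ m * (((g : GL (Fin 3) K)⁻¹ : GL (Fin 3) K) : Matrix (Fin 3) (Fin 3) K) i j) ≤ 1)
    (hinv : ∀ (m : ℕ) (g : ↥(unitaryGroupOfForm σ J)), g ∈ Ω m → g⁻¹ ∈ Ω m)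
    (hmul : ∀ (a b : ℕ) (g h : ↥(unitaryGroupOfForm σ J)), g ∈ Ω a → h ∈ Ω b → g * h ∈ Ω (a + b))
    {m : ℕ} (hm : 1 ≤ m) {E : Type*} [NormedAddCommGroup E] [NormedSpace ℝ E]
    (f : ↥(unitaryGroupOfForm σ J) → E) (hf : Continuous f)
    (hsupp : ∃ C : Set ↥(unitaryGroupOfForm σ J), IsCompact C ∧ ∀ g, f g ≠ 0 → g ∈ C * ((torusU σ J : Subgroup ↥(unitaryGroupOfForm σ J)) : Set ↥(unitaryGroupOfForm σ J)))
    (hcusp : ∀ x : ↥(unitaryGroupOfForm σ J), ∫ n : ↥((borelTriple σ J hJ).N), f (x * ↑n) ∂ν = 0)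
    (hcuspbar : ∀ x : ↥(unitaryGroupOfForm σ J), ∫ v : ↥(((borelTriple σ J hJ).N).map (MulAut.conj (weylLongU σ hJ)).toMonoidHom), f (x * ↑v) ∂νbar = 0) :
    ∃ mC : ℕ, ∀ (s : ℕ) (y : ↥(unitaryGroupOfForm σ J)), y ∈ Ω s → ∀ x : ↥(unitaryGroupOfForm σ J), x ∉ Ω (mC + (m + 2 * s + 4 * mC) + s) →
      ∫ k in (((congruenceGL 3 (valuation K ϖ ^ m)).comap (unitaryGroupOfForm σ J).subtype ⊓
          ((congruenceGL 3 (valuation K ϖ ^ m)).comap (unitaryGroupOfForm σ J).subtype).map (MulAut.conj y⁻¹).toMonoidHom :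
            Subgroup ↥(unitaryGroupOfForm σ J)) : Set ↥(unitaryGroupOfForm σ J)), f (x * y * k) ∂μ = 0 := by
  obtain ⟨C, hCc, hC⟩ := hsupp
  obtain ⟨mC, hmC⟩ := Ω.exists_superset_of_isCompact hCc
  exact ⟨mC, fun s y hy x hx => cuspForm_cancellation_U3 σ hσc hσv hJ μ ν νbar hϖ Ω hmem hinv hmul hm hy f hf C hmC hC hcusp hcuspbar hx⟩

end Model

end Summit.HodgeConjecture.HodgeConjecture.Cruxes.H413.K2E3CuspFormCancellationU3LevelOne

end
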